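import Literature.Barriers.QuantumAdvantage.NoFreeFrameCubeGraphFlat
import Literature.Computability.QuantumComplexity.DecisionDiagrams
import HarnessLib

/-!
# `cubeGraphFlat` holds: the data-loading state of the cube map is `2^{1−n/2}`-flat

Barrier catalogue `Literature/Barriers/QuantumAdvantage/` (D-0021). Proofs only (no definitions, no
named facts): the discharge of the named fact `Literature.Barriers.QuantumAdvantage.cubeGraphFlat` of
`NoFreeFrameCubeGraphFlat.lean`: for every finite field `K` with `2 ^ n` elements and every additive
identification `e : K ≃+ (Fin n → ZMod 2)`, the unnormalised graph vector `g = Σ_x |x⟩|e((e⁻¹x)³)⟩` on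
`n + n` qubits satisfies `|⟨g| σ_S |g⟩| ≤ 2 · √2 ^ n` for every Pauli string `S ≠ I`.

Structure (the S-box dictionary specialised to `x ↦ x³`): for a `{0,1}`-vector `1_P`, `⟨1_P| σ_S |1_P⟩`
is the sum of the unimodular row phases over the points `w` with `P w ∧ P (w ⊕ flips S)` (closed form
of the action of a Pauli string, `SpinorFlattening.magicInvariant_pauliString_mulVec_apply`); if `S`
flips a bit, those points inject into the solutions of `(u + α)³ + u³ = β` with `(α, β) ≠ (0, 0)` (at
most two: `x ↦ x³` is almost perfect nonlinear); a `Z`-type string gives a Walsh coefficient of `x³`,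
bounded by near-bentness `|Σ_u (−1)^{φ u + ψ (u³)}| ≤ 2 √|K|` for additive `φ, ψ : K →+ ZMod 2`,
`ψ ≠ 0` (square, substitute `v = u + t`, count the `t` with a trivial inner character sum: at most
`1 + 3`). No trace form is used: the functional `ψ` itself plays the role of `Tr(β ·)`.

PROVENANCE. The barrier docstring of `cubeGraphFlat` records that this statement was machine-checked in
the tree as `Summit.QuantumAdvantage.QuantumAdvantage.Theorems.SymplecticPurity.CubeGraphFlat_proof`
(item stmt-QuantumAdvantage-9836 of the retired route `SymplecticPurity`), with a body definitionally
equal to the Literature `def`; `Literature` cannot import `Summits`, so the proof — the files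
`Summits/QuantumAdvantage/QuantumAdvantage/Theorems/SymplecticPurityCubeGraphFlat{Field,}.lean` and the
two closed-form lemmas `magicInvariant_pauliString_apply` / `magicInvariant_pauliString_mulVec_apply` of
`…/Theorems/SpinorFlatteningNegApproxGaussRankSuperpolyMagicInvariant.lean`, which use only Mathlib and
`Literature.Computability.QuantumComplexity.{PauliExpansion, DecisionDiagrams}` — is carried over here
verbatim, one `section` per source file, as private helper lemmas in the sub-namespace
`…QuantumAdvantage.CubeGraphFlat`, and closed as `cubeGraphFlat_holds`.

## References

* [Gold1968] R. Gold, *Maximal recursive sequences with 3-valued recursive cross-correlation functions*,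
  IEEE Trans. Inform. Theory 14 (1968), 154–156.
* [Nyberg1994] K. Nyberg, *Differentially uniform mappings for cryptography*, EUROCRYPT '93, LNCS 765
  (1994), 55–64.
* [Carlet2020] C. Carlet, *Boolean Functions for Cryptography and Coding Theory*, CUP (2020/2021),
  §11.5.2 and PDF pp. 222–223.
-/

noncomputable section

namespace Literature.Barriers.QuantumAdvantage

open Matrix Finset
open scoped InnerProductSpace
open Literature.Computability.QuantumComplexity Literature.Computability.Cryptography

namespace CubeGraphFlat

section PauliAction

/-! ### Source `SpinorFlatteningNegApproxGaussRankSuperpolyMagicInvariant.lean` (excerpt) — the closed form of the action of a Pauli string on a state vector -/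

namespace SpinorFlattening

/-- Entries of a Pauli string: row `x` of `σ_S` has its single nonzero entry
`∏_w rowPhase (S w) (x w)` in the column `x ⊕ flips S` (letterwise `Pauli.mat_apply_eq_ite`).
[folklore] -/
private theorem magicInvariant_pauliString_apply {n : ℕ} (S : Fin n → Pauli) (x y : QReg n) :
    pauliString S x y =
      if ∀ w, y w = Bool.xor (x w) (S w).flipsBit then ∏ w, Pauli.rowPhase (S w) (x w) else 0 := by
  rw [pauliString_eq, tensorAll_apply]
  simp_rw [Pauli.mat_apply_eq_ite]
  rw [Fintype.prod_ite_zero]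
  split_ifs <;> rfl

/-- **Action of a Pauli string on a state vector** in closed form:
`(σ_S ψ)(x) = (∏_w rowPhase (S w) (x w)) · ψ (fun w => x w ⊕ flipsBit (S w))`.
[folklore] -/
private theorem magicInvariant_pauliString_mulVec_apply {n : ℕ} (S : Fin n → Pauli) (ψ : QReg n → ℂ)
    (x : QReg n) :
    (pauliString S *ᵥ ψ) x =
      (∏ w, Pauli.rowPhase (S w) (x w)) * ψ (fun w => Bool.xor (x w) (S w).flipsBit) := by
  simp only [Matrix.mulVec, dotProduct, magicInvariant_pauliString_apply]
  rw [Finset.sum_eq_single (fun w => Bool.xor (x w) (S w).flipsBit)]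
  · rw [if_pos fun w => rfl]
  · intro y _ hy
    rw [if_neg fun h => hy (funext h), zero_mul]
  · exact fun h => absurd (Finset.mem_univ _) h


end SpinorFlattening

end PauliAction

section FieldSide

/-! ### Source `SymplecticPurityCubeGraphFlatField.lean` — field-side helpers: APN and near-bentness of `x ↦ x³` for additive functionals

Original module docstring:

# Route `SymplecticPurity`, item `CubeGraphFlat` (stmt-QuantumAdvantage-9836) — field-side helpers

Elementary facts about a finite field `K` with `2 ^ n` elements behind the almost-bent witness
`x ↦ x³` (Gold 1968; Nyberg, EUROCRYPT '93; Carlet, *Boolean Functions for Cryptography and Coding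
Theory* (2021), ch. 11), written for ADDITIVE functionals `K →+ ZMod 2` (every `𝔽₂`-linear
identification `K ≃ 𝔽₂ⁿ` turns the coordinate masks of a Pauli `Z`-string into such functionals):

* `two_eq_zero_of_card` — `2 = 0` in `K`;
* `sum_sign_eq_zero` — a non-zero additive character sums to `0` over `K`;
* `card_filter_cube_diff_le_two` — `x ↦ x³` is almost perfect nonlinear: `(u + α)³ + u³ = β` has at
  most two solutions when `(α, β) ≠ (0, 0)` (a quadratic in `u`);
* `sq_walsh_cube_le` / `abs_walsh_cube_le` — near-bentness: for additive `φ ψ : K →+ ZMod 2` with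
  `ψ ≠ 0`, `|Σ_u (−1)^{φ u + ψ (u³)}| ≤ 2 √|K|`. Proof: square and substitute `v = u + t`; the inner
  sum is the character sum of the ADDITIVE map `u ↦ ψ (t u² + t² u)`, hence `|K|` or `0`; the set of
  `t` where it is `|K|` consists of `0` and elements with one common cube (if `t₁, t₂ ≠ 0` are both
  in it, take `c` with `t₁ c² = t₂` — squares exist in characteristic two — and compare), so it has
  at most `1 + 3 = 4` elements.

No trace form is used: the functional `ψ` itself plays the role of `Tr(β ·)`.
-/


open Finset Polynomial

variable {K : Type*} [Field K] [Fintype K]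

/-- The two elements of `ZMod 2`. [folklore] -/
private theorem zmod_two_eq_zero_or_eq_one (z : ZMod 2) : z = 0 ∨ z = 1 := by
  revert z; decide

/-- In `ZMod 2`, `a + b = 0 ↔ a = b`. [folklore] -/
private theorem zmod_two_add_eq_zero_iff (a b : ZMod 2) : a + b = 0 ↔ a = b := by
  revert a b; decide

/-- Multiplicativity of the real sign character of `ZMod 2`: `(−1)^x (−1)^y = (−1)^{x+y}`. [folklore] -/
private theorem sign_mul_sign (x y : ZMod 2) :
    (if x = 0 then (1 : ℝ) else -1) * (if y = 0 then (1 : ℝ) else -1) =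
      if x + y = 0 then (1 : ℝ) else -1 := by
  have h10 : (1 : ZMod 2) ≠ 0 := by decide
  have h11 : (1 : ZMod 2) + 1 = 0 := by decide
  rcases zmod_two_eq_zero_or_eq_one x with rfl | rfl <;>
    rcases zmod_two_eq_zero_or_eq_one y with rfl | rfl <;> simp [h10, h11]

/-- The sign character of a finite sum is the product of the sign characters. [folklore] -/
private theorem prod_sign_eq {ι : Type*} (s : Finset ι) (z : ι → ZMod 2) :
    ∏ i ∈ s, (if z i = 0 then (1 : ℝ) else -1) = if ∑ i ∈ s, z i = 0 then (1 : ℝ) else -1 := by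
  classical
  induction s using Finset.induction_on with
  | empty => simp
  | insert a s ha ih => rw [Finset.prod_insert ha, Finset.sum_insert ha, ih, sign_mul_sign]

/-- A finite field with `2 ^ n` elements has characteristic two: `2 = 0` (and `n ≠ 0`). [folklore] -/
private theorem two_eq_zero_of_card {n : ℕ} (hK : Fintype.card K = 2 ^ n) : (2 : K) = 0 := by
  have hn : n ≠ 0 := by
    rintro rfl
    have h1 := Fintype.one_lt_card (α := K)
    rw [hK, pow_zero] at h1
    exact lt_irrefl _ h1
  have h := FiniteField.cast_card_eq_zero K
  rw [hK, Nat.cast_pow, Nat.cast_ofNat] at h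
  exact (pow_eq_zero_iff hn).1 h

/-- A finite field with `2 ^ n` elements has `ringChar K = 2`. [folklore] -/
private theorem ringChar_eq_two_of_card {n : ℕ} (hK : Fintype.card K = 2 ^ n) : ringChar K = 2 :=
  CharP.ringChar_of_prime_eq_zero Nat.prime_two (by exact_mod_cast two_eq_zero_of_card hK)

/-- A non-zero additive functional `L : K →+ ZMod 2` is balanced: `Σ_u (−1)^{L u} = 0`. [folklore] -/
private theorem sum_sign_eq_zero {G : Type*} [AddCommGroup G] [Fintype G] (L : G →+ ZMod 2) (hL : L ≠ 0) :
    ∑ u : G, (if L u = 0 then (1 : ℝ) else -1) = 0 := by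
  obtain ⟨u₀, hu₀⟩ : ∃ u₀, L u₀ ≠ 0 := by
    by_contra h
    push Not at h
    exact hL (AddMonoidHom.ext h)
  have h1 : L u₀ = 1 := (zmod_two_eq_zero_or_eq_one _).resolve_left hu₀
  have h10 : (1 : ZMod 2) ≠ 0 := by decide
  have h11 : (1 : ZMod 2) + 1 = 0 := by decide
  have hS : ∑ u : G, (if L u = 0 then (1 : ℝ) else -1) =
      ∑ u : G, (if L (u + u₀) = 0 then (1 : ℝ) else -1) :=
    (Equiv.sum_comp (Equiv.addRight u₀) (fun u => if L u = 0 then (1 : ℝ) else -1)).symm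
  have hneg : ∀ u : G, (if L (u + u₀) = 0 then (1 : ℝ) else -1) = -(if L u = 0 then (1 : ℝ) else -1) := by
    intro u
    rw [map_add, h1]
    rcases zmod_two_eq_zero_or_eq_one (L u) with h | h <;> simp [h, h10, h11]
  simp_rw [hneg, Finset.sum_neg_distrib] at hS
  linarith

omit [Fintype K] in
/-- For a non-zero additive functional `ψ` on a field, `u ↦ ψ (γ u)` vanishes identically only for
`γ = 0` (the pairing `(γ, u) ↦ ψ (γ u)` is non-degenerate).
[folklore] -/
private theorem eq_zero_of_forall_apply_mul_eq_zero (ψ : K →+ ZMod 2) (hψ : ψ ≠ 0) (γ : K)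
    (h : ∀ u : K, ψ (γ * u) = 0) : γ = 0 := by
  by_contra hγ
  apply hψ
  ext y
  have hy := h (γ⁻¹ * y)
  rwa [← mul_assoc, mul_inv_cancel₀ hγ, one_mul] at hy

/-- **`x ↦ x³` is APN** (Nyberg 1993; Carlet 2021, ch. 11): in characteristic two the equation
`(u + α)³ + u³ = β`, i.e. `α u² + α² u + α³ = β`, has at most two solutions `u` whenever
`(α, β) ≠ (0, 0)` (for `α = 0 ≠ β` it has none).
[folklore] -/
private theorem card_filter_cube_diff_le_two [DecidableEq K] (h2 : (2 : K) = 0) (α β : K)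
    (hαβ : α ≠ 0 ∨ β ≠ 0) :
    (Finset.univ.filter fun u : K => (u + α) ^ 3 + u ^ 3 = β).card ≤ 2 := by
  rcases eq_or_ne α 0 with rfl | hα
  · have hβ : β ≠ 0 := hαβ.resolve_left (fun h => h rfl)
    have he : (Finset.univ.filter fun u : K => (u + 0) ^ 3 + u ^ 3 = β) = ∅ := by
      refine Finset.filter_eq_empty_iff.mpr ?_
      intro u _ hu
      apply hβ
      rw [← hu]
      linear_combination (u ^ 3) * h2
    rw [he, Finset.card_empty]
    exact Nat.zero_le _
  · set p : K[X] := C α * X ^ 2 + C (α ^ 2) * X + C (α ^ 3 - β) with hp_def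
    have hp : p ≠ 0 := by
      intro h0
      have hc := congrArg (fun q : K[X] => q.coeff 2) h0
      simp only [hp_def, coeff_add, coeff_C_mul, coeff_X_pow, coeff_X, coeff_C, coeff_zero] at hc
      norm_num at hc
      exact hα hc
    calc (Finset.univ.filter fun u : K => (u + α) ^ 3 + u ^ 3 = β).card
        ≤ p.roots.toFinset.card := by
          refine Finset.card_le_card fun u hu => ?_
          rw [Finset.mem_filter] at hu
          rw [Multiset.mem_toFinset, Polynomial.mem_roots hp, Polynomial.IsRoot.def]
          simp only [hp_def, eval_add, eval_mul, eval_C, eval_pow, eval_X]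
          linear_combination hu.2 - (u ^ 3 + α * u ^ 2 + α ^ 2 * u) * h2
      _ ≤ Multiset.card p.roots := Multiset.toFinset_card_le _
      _ ≤ p.natDegree := Polynomial.card_roots' p
      _ ≤ 2 := Polynomial.natDegree_quadratic_le

/-- Key step of the near-bent bound: if `t₁, t₂ ≠ 0` both make the additive map
`u ↦ ψ (t u² + t² u)` vanish identically (`ψ ≠ 0` additive), then `t₁³ = t₂³`.  (Take `c` with
`t₁ c² = t₂`; then `ψ (t₂ u²) = ψ (t₁² c u)` and `= ψ (t₂² u)`, so `t₁² c = t₂²`; square and compare.)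
[folklore] -/
private theorem cube_eq_cube_of_kernel (h2 : (2 : K) = 0) (hchar : ringChar K = 2) (ψ : K →+ ZMod 2)
    (hψ : ψ ≠ 0) {t₁ t₂ : K} (ht₁ : t₁ ≠ 0) (ht₂ : t₂ ≠ 0)
    (h₁ : ∀ u : K, ψ (t₁ * u ^ 2 + t₁ ^ 2 * u) = 0)
    (h₂ : ∀ u : K, ψ (t₂ * u ^ 2 + t₂ ^ 2 * u) = 0) : t₁ ^ 3 = t₂ ^ 3 := by
  obtain ⟨c, hc⟩ := FiniteField.isSquare_of_char_two hchar (t₂ / t₁)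
  have hE1 : t₁ * c ^ 2 = t₂ := by
    rw [sq, ← hc]
    field_simp
  have h₁' : ∀ u : K, ψ (t₁ * u ^ 2) = ψ (t₁ ^ 2 * u) := fun u =>
    (zmod_two_add_eq_zero_iff _ _).1 (by rw [← map_add]; exact h₁ u)
  have h₂' : ∀ u : K, ψ (t₂ * u ^ 2) = ψ (t₂ ^ 2 * u) := fun u =>
    (zmod_two_add_eq_zero_iff _ _).1 (by rw [← map_add]; exact h₂ u)
  have hγ : t₁ ^ 2 * c + t₂ ^ 2 = 0 := by
    refine eq_zero_of_forall_apply_mul_eq_zero ψ hψ _ fun u => ?_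
    rw [add_mul, map_add, zmod_two_add_eq_zero_iff]
    have hu := h₁' (c * u)
    rw [show t₁ * (c * u) ^ 2 = t₂ * u ^ 2 by rw [← hE1]; ring] at hu
    rw [show t₁ ^ 2 * c * u = t₁ ^ 2 * (c * u) by ring, ← hu, h₂' u]
  have hE2 : t₁ ^ 2 * c = t₂ ^ 2 := by linear_combination hγ - (t₂ ^ 2) * h2
  have h3 : (t₁ ^ 3 - t₂ ^ 3) * t₂ = 0 := by
    linear_combination (t₁ ^ 2 * c + t₂ ^ 2) * hE2 - t₁ ^ 3 * hE1
  rcases mul_eq_zero.1 h3 with h | h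
  · exact sub_eq_zero.1 h
  · exact absurd h ht₂

/-- The set of `t` for which `u ↦ ψ (t u² + t² u)` vanishes identically has at most four elements:
`0` and at most three non-zero elements sharing one cube.
[folklore] -/
private theorem card_filter_kernel_le_four (h2 : (2 : K) = 0) (hchar : ringChar K = 2) (ψ : K →+ ZMod 2)
    (hψ : ψ ≠ 0) :
    (Finset.univ.filter fun t : K => ∀ u : K, ψ (t * u ^ 2 + t ^ 2 * u) = 0).card ≤ 4 := by
  classical
  set T := Finset.univ.filter fun t : K => ∀ u : K, ψ (t * u ^ 2 + t ^ 2 * u) = 0 with hT_def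
  by_cases hT : ∃ t₀ ∈ T, t₀ ≠ 0
  · obtain ⟨t₀, ht₀T, ht₀⟩ := hT
    have hsub : T.erase 0 ⊆ (Polynomial.nthRoots 3 (t₀ ^ 3)).toFinset := by
      intro t ht
      rw [Finset.mem_erase] at ht
      rw [Multiset.mem_toFinset, Polynomial.mem_nthRoots (by norm_num : 0 < 3)]
      exact cube_eq_cube_of_kernel h2 hchar ψ hψ ht.1 ht₀ (Finset.mem_filter.1 ht.2).2
        (Finset.mem_filter.1 ht₀T).2
    have h0 : (0 : K) ∈ T := by
      rw [hT_def, Finset.mem_filter]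
      exact ⟨Finset.mem_univ _, fun u => by simp⟩
    calc T.card = (T.erase 0).card + 1 := (Finset.card_erase_add_one h0).symm
      _ ≤ (Polynomial.nthRoots 3 (t₀ ^ 3)).toFinset.card + 1 := by
          gcongr
      _ ≤ Multiset.card (Polynomial.nthRoots 3 (t₀ ^ 3)) + 1 := by
          gcongr
          exact Multiset.toFinset_card_le _
      _ ≤ 3 + 1 := by
          gcongr
          exact Polynomial.card_nthRoots 3 _
  · push Not at hT
    calc T.card ≤ ({0} : Finset K).card :=
          Finset.card_le_card fun t ht => Finset.mem_singleton.2 (hT t ht)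
      _ ≤ 4 := by rw [Finset.card_singleton]; norm_num

/-- **Near-bentness of `x ↦ x³`, squared form** (Gold 1968; Carlet 2021, ch. 11): for additive
`φ ψ : K →+ ZMod 2` with `ψ ≠ 0`, `(Σ_u (−1)^{φ u + ψ (u³)})² ≤ 4 |K|`.
[folklore] -/
private theorem sq_walsh_cube_le (h2 : (2 : K) = 0) (hchar : ringChar K = 2) (φ ψ : K →+ ZMod 2)
    (hψ : ψ ≠ 0) :
    (∑ u : K, (if φ u + ψ (u ^ 3) = 0 then (1 : ℝ) else -1)) ^ 2 ≤ 4 * Fintype.card K := by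
  classical
  have hsq : ∀ u v : K, (u + v) ^ 2 = u ^ 2 + v ^ 2 := fun u v => by
    linear_combination (u * v) * h2
  -- the inner additive functional `u ↦ ψ (t u² + t² u)`
  let L : K → K →+ ZMod 2 := fun t =>
    AddMonoidHom.mk' (fun u => ψ (t * u ^ 2 + t ^ 2 * u)) fun u v => by
      rw [← map_add, hsq]
      congr 1
      ring
  have hL : ∀ t u, L t u = ψ (t * u ^ 2 + t ^ 2 * u) := fun t u => rfl
  -- Step 1: the square as a double sum, `v = u + t`
  have key : (∑ u : K, (if φ u + ψ (u ^ 3) = 0 then (1 : ℝ) else -1)) ^ 2 =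
      ∑ t : K, (if φ t + ψ (t ^ 3) = 0 then (1 : ℝ) else -1) *
        ∑ u : K, (if L t u = 0 then (1 : ℝ) else -1) := by
    rw [sq, Finset.sum_mul_sum]
    have hre : ∀ u : K, ∑ v : K, (if φ u + ψ (u ^ 3) = 0 then (1 : ℝ) else -1) *
        (if φ v + ψ (v ^ 3) = 0 then (1 : ℝ) else -1) =
        ∑ t : K, (if φ u + ψ (u ^ 3) = 0 then (1 : ℝ) else -1) *
          (if φ (u + t) + ψ ((u + t) ^ 3) = 0 then (1 : ℝ) else -1) := fun u =>
      (Equiv.sum_comp (Equiv.addLeft u) _).symm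
    simp_rw [hre]
    rw [Finset.sum_comm]
    refine Finset.sum_congr rfl fun t _ => ?_
    rw [Finset.mul_sum]
    refine Finset.sum_congr rfl fun u _ => ?_
    rw [sign_mul_sign, sign_mul_sign, hL]
    have hcube : (u + t) ^ 3 = u ^ 3 + (t * u ^ 2 + t ^ 2 * u) + t ^ 3 := by
      linear_combination (u ^ 2 * t + u * t ^ 2) * h2
    rw [hcube, map_add, map_add, map_add]
    have hzz : ∀ x y z w v : ZMod 2, x + y + (x + z + (y + w + v)) = z + v + w := by decide
    rw [hzz]
  -- Step 2: the inner sums are `|K|` or `0`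
  have hI : ∀ t : K, ∑ u : K, (if L t u = 0 then (1 : ℝ) else -1) =
      if L t = 0 then (Fintype.card K : ℝ) else 0 := by
    intro t
    split_ifs with h
    · simp [h]
    · exact sum_sign_eq_zero (L t) h
  rw [key]
  simp_rw [hI]
  calc ∑ t : K, (if φ t + ψ (t ^ 3) = 0 then (1 : ℝ) else -1) *
        (if L t = 0 then (Fintype.card K : ℝ) else 0)
      ≤ ∑ t : K, (if L t = 0 then (Fintype.card K : ℝ) else 0) := by
        refine Finset.sum_le_sum fun t _ => mul_le_of_le_one_left ?_ ?_
        · split_ifs <;> simp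
        · split_ifs <;> norm_num
    _ = ((Finset.univ.filter fun t : K => L t = 0).card : ℝ) * Fintype.card K := by
        rw [← Finset.sum_filter, Finset.sum_const, nsmul_eq_mul]
    _ ≤ 4 * Fintype.card K := by
        gcongr
        have hTT : (Finset.univ.filter fun t : K => L t = 0) =
            Finset.univ.filter fun t : K => ∀ u : K, ψ (t * u ^ 2 + t ^ 2 * u) = 0 := by
          refine Finset.filter_congr fun t _ => ?_
          rw [AddMonoidHom.ext_iff]
          rfl
        rw [hTT]
        exact_mod_cast card_filter_kernel_le_four h2 hchar ψ hψ

/-- **Near-bentness of `x ↦ x³`** (Gold 1968; Nyberg 1993; Carlet 2021, ch. 11): in a field with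
`2 ^ n` elements, for additive `φ ψ : K →+ ZMod 2` with `ψ ≠ 0`,
`|Σ_u (−1)^{φ u + ψ (u³)}| ≤ 2 · √2 ^ n`.
[folklore] -/
private theorem abs_walsh_cube_le {n : ℕ} (hK : Fintype.card K = 2 ^ n) (φ ψ : K →+ ZMod 2) (hψ : ψ ≠ 0) :
    |∑ u : K, (if φ u + ψ (u ^ 3) = 0 then (1 : ℝ) else -1)| ≤ 2 * Real.sqrt 2 ^ n := by
  have h := sq_walsh_cube_le (two_eq_zero_of_card hK) (ringChar_eq_two_of_card hK) φ ψ hψ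
  rw [hK] at h
  push_cast at h
  have hb : (2 * Real.sqrt 2 ^ n) ^ 2 = 4 * (2 : ℝ) ^ n := by
    rw [mul_pow, ← pow_mul, mul_comm n 2, pow_mul, Real.sq_sqrt (by norm_num : (0 : ℝ) ≤ 2)]
    norm_num
  have h' : (∑ u : K, (if φ u + ψ (u ^ 3) = 0 then (1 : ℝ) else -1)) ^ 2 ≤ (2 * Real.sqrt 2 ^ n) ^ 2 := by
    rw [hb]; exact h
  exact abs_le.2 (abs_le_of_sq_le_sq' h' (by positivity))


end FieldSide

section Main

/-! ### Source `SymplecticPurityCubeGraphFlat.lean` — the closing file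

Original module docstring:

# Route `SymplecticPurity`, item `CubeGraphFlat` (stmt-QuantumAdvantage-9836) — PROOF

`theorem CubeGraphFlat_proof : …Theses.SymplecticPurity.CubeGraphFlat`: for every finite field `K`
with `2 ^ n` elements and every additive identification `e : K ≃+ (Fin n → ZMod 2)`, the unnormalised
graph vector `g = Σ_x |x⟩|e((e⁻¹x)³)⟩` on `n + n` qubits satisfies `|⟨g| σ_S |g⟩| ≤ 2 · √2 ^ n` for
every Pauli string `S ≠ I` (the data-loading state of the cube S-box is `2^{1−n/2}`-flat).

Structure (the S-box dictionary of the route, specialised to `x ↦ x³`):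

* `indicator_dot_pauliString_mulVec` — for a `{0,1}`-vector `1_P`, `⟨1_P| σ_S |1_P⟩` is the sum of
  the unimodular row phases over the points `w` with `P w ∧ P (w ⊕ flips S)` (closed form of the
  action of a Pauli string, `SpinorFlattening.magicInvariant_pauliString_mulVec_apply`); hence
  `norm_indicator_dot_le_card`.
* `card_cube_graph_pairs_le_two` — if `S` flips a bit, those points inject into the solutions of
  `(u + α)³ + u³ = β` with `(α, β) ≠ (0, 0)` the flip pattern read in `K` (additivity of `e`), at most
  two by almost perfect nonlinearity (`card_filter_cube_diff_le_two`, field file).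
* `graph_dot_eq_sum_of_noflip` — for a flip-free (`I/Z`) string the expectation in a graph state
  `Σ_x |x⟩|f x⟩` is `Σ_x ∏ rowPhase`, i.e. (`rowPhase_eq_sign_of_noflip`, `prod_sign_eq`) the Walsh sum
  `Σ_u (−1)^{φ u + ψ (u³)}` of the two coordinate masks transported through `e` to additive
  functionals `φ ψ : K →+ ZMod 2`; it vanishes when `ψ = 0 ≠ φ` and is at most `2 √2 ^ n` in absolute
  value when `ψ ≠ 0` (`abs_walsh_cube_le`, field file: Gold 1968 / Nyberg 1993 near-bentness).

Sources: R. Gold, IEEE Trans. Inform. Theory 14 (1968) 154–156; K. Nyberg, EUROCRYPT '93 (LNCS 765)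
55–64; C. Carlet, *Boolean Functions for Cryptography and Coding Theory* (CUP 2021), ch. 11.
-/


open Matrix Finset Literature.Computability.QuantumComplexity Literature.Computability.Cryptography

/-- The row phases of the Pauli letters are unimodular. [folklore] -/
private theorem norm_rowPhase (Q : Pauli) (b : Bool) : ‖Pauli.rowPhase Q b‖ = 1 := by
  cases Q <;> cases b <;> simp [Pauli.rowPhase]

/-- **Expectation of a Pauli string in an indicator vector**: for the `{0,1}`-vector `1_P` of a
predicate `P` on the register, `⟨1_P| σ_S |1_P⟩ = Σ_{w : P w ∧ P (w ⊕ flips S)} ∏_k rowPhase (S k) (w k)`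
(row `w` of `σ_S` has its only entry in column `w ⊕ flips S`).
[folklore] -/
private theorem indicator_dot_pauliString_mulVec {N : ℕ} (S : Fin N → Pauli) (P : QReg N → Prop)
    [DecidablePred P] :
    star (fun w => if P w then (1 : ℂ) else 0) ⬝ᵥ
        ((pauliString S) *ᵥ fun w => if P w then (1 : ℂ) else 0) =
      ∑ w ∈ Finset.univ.filter (fun w : QReg N => P w ∧ P (fun k => Bool.xor (w k) (S k).flipsBit)),
        ∏ k, Pauli.rowPhase (S k) (w k) := by
  rw [dotProduct, Finset.sum_filter]
  refine Finset.sum_congr rfl fun w _ => ?_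
  rw [SpinorFlattening.magicInvariant_pauliString_mulVec_apply, Pi.star_apply]
  by_cases h1 : P w <;> by_cases h2 : P (fun k => Bool.xor (w k) (S k).flipsBit) <;> simp [h1, h2]

/-- Triangle inequality: `|⟨1_P| σ_S |1_P⟩| ≤ #{w : P w ∧ P (w ⊕ flips S)}`. [folklore] -/
private theorem norm_indicator_dot_le_card {N : ℕ} (S : Fin N → Pauli) (P : QReg N → Prop)
    [DecidablePred P] :
    ‖star (fun w => if P w then (1 : ℂ) else 0) ⬝ᵥ
        ((pauliString S) *ᵥ fun w => if P w then (1 : ℂ) else 0)‖ ≤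
      (Finset.univ.filter (fun w : QReg N => P w ∧ P (fun k => Bool.xor (w k) (S k).flipsBit))).card := by
  rw [indicator_dot_pauliString_mulVec]
  refine (norm_sum_le _ _).trans ?_
  simp [norm_prod, norm_rowPhase]

/-- A label of `n + m` wires is determined by its first `n` and last `m` coordinates. [folklore] -/
private theorem qreg_ext_of_castAdd_natAdd {n m : ℕ} {w₁ w₂ : QReg (n + m)}
    (hx : (fun i : Fin n => w₁ (Fin.castAdd m i)) = fun i => w₂ (Fin.castAdd m i))
    (hy : (fun j : Fin m => w₁ (Fin.natAdd n j)) = fun j => w₂ (Fin.natAdd n j)) : w₁ = w₂ := by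
  rw [← Fin.append_castAdd_natAdd (f := w₁), ← Fin.append_castAdd_natAdd (f := w₂), hx, hy]

/-- **Z-type strings on a graph state**: for `f : QReg n → QReg n` and a string `S` without bit flips
(letters `I`, `Z` only), `⟨g_f| σ_S |g_f⟩ = Σ_x ∏_i rowPhase (S_i) (x_i) · ∏_j rowPhase (S_{n+j}) (f x)_j`,
where `g_f = Σ_x |x⟩|f x⟩` is the (unnormalised) graph vector.
[folklore] -/
private theorem graph_dot_eq_sum_of_noflip {n : ℕ} (f : QReg n → QReg n) (S : Fin (n + n) → Pauli)
    (hfl : ∀ k, (S k).flipsBit = false) :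
    star (fun w : QReg (n + n) =>
        if (fun j : Fin n => w (Fin.natAdd n j)) = f (fun i : Fin n => w (Fin.castAdd n i)) then (1 : ℂ) else 0) ⬝ᵥ
      ((pauliString S) *ᵥ fun w : QReg (n + n) =>
        if (fun j : Fin n => w (Fin.natAdd n j)) = f (fun i : Fin n => w (Fin.castAdd n i)) then (1 : ℂ) else 0) =
    ∑ x : QReg n, (∏ i : Fin n, Pauli.rowPhase (S (Fin.castAdd n i)) (x i)) *
      ∏ j : Fin n, Pauli.rowPhase (S (Fin.natAdd n j)) (f x j) := by
  rw [indicator_dot_pauliString_mulVec]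
  simp only [hfl, Bool.xor_false, and_self]
  refine Finset.sum_nbij' (fun w => fun i => w (Fin.castAdd n i)) (fun x => Fin.append x (f x))
    ?_ ?_ ?_ ?_ ?_
  · intro w _
    exact Finset.mem_univ _
  · intro x _
    rw [Finset.mem_filter]
    refine ⟨Finset.mem_univ _, ?_⟩
    funext j
    simp only [Fin.append_right, Fin.append_left]
  · intro w hw
    rw [Finset.mem_filter] at hw
    rw [← hw.2]
    exact Fin.append_castAdd_natAdd
  · intro x _
    funext i
    exact Fin.append_left _ _ _
  · intro w hw
    rw [Finset.mem_filter] at hw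
    rw [Fin.prod_univ_add, ← hw.2]

/-- For a string without bit flips (letters `I`, `Z`), each row phase is the real sign
`(−1)^{[S_k = Z]·b}`.
[folklore] -/
private theorem rowPhase_eq_sign_of_noflip {ι : Type*} (S : ι → Pauli) (hfl : ∀ k, (S k).flipsBit = false)
    (k : ι) (b : Bool) :
    Pauli.rowPhase (S k) b =
      ((if (if S k = Pauli.Z then (1 : ZMod 2) else 0) * (if b then (1 : ZMod 2) else 0) = 0
        then (1 : ℝ) else -1 : ℝ) : ℂ) := by
  have h10 : (1 : ZMod 2) ≠ 0 := by decide
  have hk := hfl k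
  revert hk
  cases S k <;> cases b <;> simp [Pauli.flipsBit, Pauli.rowPhase, h10]

/-- A letter without bit flip is `I` or `Z`. [folklore] -/
private theorem eq_I_or_eq_Z_of_flipsBit {Q : Pauli} (hQ : Q.flipsBit = false) : Q = Pauli.I ∨ Q = Pauli.Z := by
  cases Q <;> simp_all [Pauli.flipsBit]

/-- The bit vector `x ↦ (x_i : ZMod 2)` is injective. [folklore] -/
private theorem bits_injective {n : ℕ} {x y : QReg n}
    (h : (fun i => if x i then (1 : ZMod 2) else 0) = fun i => if y i then (1 : ZMod 2) else 0) : x = y := by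
  funext i
  have hi := congrFun h i
  have h10 : (1 : ZMod 2) ≠ 0 := by decide
  revert hi
  cases x i <;> cases y i <;> simp [h10, h10.symm]

/-- The bit vector of `x ⊕ a` is the sum of the bit vectors. [folklore] -/
private theorem bits_xor {n : ℕ} (x a : QReg n) :
    (fun i => if Bool.xor (x i) (a i) then (1 : ZMod 2) else 0) =
      (fun i => if x i then (1 : ZMod 2) else 0) + fun i => if a i then (1 : ZMod 2) else 0 := by
  funext i
  simp only [Pi.add_apply]
  have h11 : (1 : ZMod 2) + 1 = 0 := by decide
  cases x i <;> cases a i <;> simp [h11]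

/-- Bit bookkeeping: if `y ⊕ b = [z₁ = 1]` and `y = [z₂ = 1]` then `z₁ + z₂` is the bit `b`. [folklore] -/
private theorem zmod_two_add_eq_bit (z₁ z₂ : ZMod 2) (b : Bool)
    (h : Bool.xor (decide (z₂ = 1)) b = decide (z₁ = 1)) : z₁ + z₂ = if b then 1 else 0 := by
  revert z₁ z₂ b h
  decide

/-- Reading a bit back: `[z = 1] = z` in `ZMod 2`. [folklore] -/
private theorem bit_eq_self (z : ZMod 2) : (if z = 1 then (1 : ZMod 2) else 0) = z := by
  revert z
  decide

/-- **X-type strings on the cube graph state** (differential uniformity): if `S` flips at least one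
bit, the pairs `{w, w ⊕ flips S}` of graph points number at most two — they inject (via the data
register, read in `K`) into the solutions of `(u + α)³ + u³ = β`, `(α, β) ≠ (0,0)` the flip pattern.
[folklore] -/
private theorem card_cube_graph_pairs_le_two {n : ℕ} {K : Type*} [Field K] [Fintype K]
    (hK : Fintype.card K = 2 ^ n) (e : K ≃+ (Fin n → ZMod 2)) (S : Fin (n + n) → Pauli)
    (hfl : ∃ k, (S k).flipsBit = true) :
    (Finset.univ.filter fun w : QReg (n + n) =>
      ((fun j : Fin n => w (Fin.natAdd n j)) = fun j : Fin n =>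
          decide (e ((e.symm fun i : Fin n => if w (Fin.castAdd n i) then 1 else 0) ^ 3) j = 1)) ∧
      ((fun j : Fin n => Bool.xor (w (Fin.natAdd n j)) (S (Fin.natAdd n j)).flipsBit) = fun j : Fin n =>
          decide (e ((e.symm fun i : Fin n =>
            if Bool.xor (w (Fin.castAdd n i)) (S (Fin.castAdd n i)).flipsBit then 1 else 0) ^ 3) j = 1))).card
      ≤ 2 := by
  classical
  have h10 : (1 : ZMod 2) ≠ 0 := by decide
  -- the flip pattern, read in `K`
  set α : K := e.symm fun i : Fin n => if (S (Fin.castAdd n i)).flipsBit then 1 else 0 with hα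
  set β : K := e.symm fun j : Fin n => if (S (Fin.natAdd n j)).flipsBit then 1 else 0 with hβ
  have hαβ : α ≠ 0 ∨ β ≠ 0 := by
    obtain ⟨k, hk⟩ := hfl
    revert hk
    refine Fin.addCases (motive := fun k => (S k).flipsBit = true → α ≠ 0 ∨ β ≠ 0)
      (fun i hi => Or.inl fun h0 => ?_) (fun j hj => Or.inr fun h0 => ?_) k
    · have h1 := congrFun (congrArg e h0) i
      rw [hα, AddEquiv.apply_symm_apply, map_zero, Pi.zero_apply] at h1
      simp only [hi, if_true] at h1
      exact h10 h1
    · have h1 := congrFun (congrArg e h0) j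
      rw [hβ, AddEquiv.apply_symm_apply, map_zero, Pi.zero_apply] at h1
      simp only [hj, if_true] at h1
      exact h10 h1
  refine le_trans (Finset.card_le_card_of_injOn
    (fun w : QReg (n + n) => e.symm fun i : Fin n => if w (Fin.castAdd n i) then 1 else 0) ?_ ?_)
    (card_filter_cube_diff_le_two (two_eq_zero_of_card hK) α β hαβ)
  · intro w hw
    rw [Finset.mem_coe, Finset.mem_filter] at hw ⊢
    refine ⟨Finset.mem_univ _, ?_⟩
    obtain ⟨h1, h2⟩ := hw.2
    rw [bits_xor, map_add, ← hα] at h2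
    apply e.injective
    rw [map_add, hβ, AddEquiv.apply_symm_apply]
    funext j
    rw [Pi.add_apply]
    have h1j := congrFun h1 j
    have h2j := congrFun h2 j
    rw [h1j] at h2j
    exact zmod_two_add_eq_bit _ _ _ h2j
  · intro w₁ hw₁ w₂ hw₂ heq
    rw [Finset.mem_coe, Finset.mem_filter] at hw₁ hw₂
    dsimp only at heq
    have hx : (fun i : Fin n => w₁ (Fin.castAdd n i)) = fun i => w₂ (Fin.castAdd n i) :=
      bits_injective (e.symm.injective heq)
    refine qreg_ext_of_castAdd_natAdd hx ?_
    rw [hw₁.2.1, hw₂.2.1, heq]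

/-- The main estimate, stated on the nose of the route item. [folklore] -/
private theorem cubeGraphFlat_main (n : ℕ) (K : Type) [Field K] [Fintype K] (hK : Fintype.card K = 2 ^ n)
    (e : K ≃+ (Fin n → ZMod 2)) (S : Fin (n + n) → Pauli) (hS : S ≠ fun _ => Pauli.I) :
    ‖star (fun w : QReg (n + n) => if (fun j : Fin n => w (Fin.natAdd n j)) = (fun j : Fin n => decide (e ((e.symm (fun i : Fin n => if w (Fin.castAdd n i) then 1 else 0)) ^ 3) j = 1)) then (1 : ℂ) else 0) ⬝ᵥ (pauliString S).mulVec (fun w : QReg (n + n) => if (fun j : Fin n => w (Fin.natAdd n j)) = (fun j : Fin n => decide (e ((e.symm (fun i : Fin n => if w (Fin.castAdd n i) then 1 else 0)) ^ 3) j = 1)) then (1 : ℂ) else 0)‖ ≤ 2 * Real.sqrt 2 ^ n := by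
  classical
  have h10 : (1 : ZMod 2) ≠ 0 := by decide
  have hsqrt : (1 : ℝ) ≤ Real.sqrt 2 ^ n := by
    refine one_le_pow₀ ?_
    rw [show (1 : ℝ) = Real.sqrt 1 from Real.sqrt_one.symm]
    exact Real.sqrt_le_sqrt (by norm_num)
  by_cases hfl : ∃ k, (S k).flipsBit = true
  · -- X-type: at most two unimodular terms
    refine le_trans (norm_indicator_dot_le_card S _) ?_
    refine le_trans (Nat.cast_le.2 (card_cube_graph_pairs_le_two hK e S hfl)) ?_
    push_cast
    linarith
  · -- Z-type: a Walsh sum of the cube map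
    push Not at hfl
    have hfl' : ∀ k, (S k).flipsBit = false := fun k => Bool.eq_false_iff.mpr (hfl k)
    have hsum := graph_dot_eq_sum_of_noflip
      (fun x : QReg n => fun j : Fin n =>
        decide (e ((e.symm fun i : Fin n => if x i then 1 else 0) ^ 3) j = 1)) S hfl'
    rw [hsum]
    simp only [rowPhase_eq_sign_of_noflip S hfl', decide_eq_true_eq, bit_eq_self]
    simp only [← Complex.ofReal_prod, ← Complex.ofReal_mul, ← Complex.ofReal_sum, prod_sign_eq,
      sign_mul_sign]
    rw [Complex.norm_real, Real.norm_eq_abs]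
    -- the two additive functionals `φ u = c · e u`, `ψ v = d · e v`
    let φ : K →+ ZMod 2 := AddMonoidHom.mk'
      (fun u => ∑ i : Fin n, (if S (Fin.castAdd n i) = Pauli.Z then (1 : ZMod 2) else 0) * e u i)
      (fun u v => by simp only [map_add, Pi.add_apply, mul_add, Finset.sum_add_distrib])
    let ψ : K →+ ZMod 2 := AddMonoidHom.mk'
      (fun u => ∑ j : Fin n, (if S (Fin.natAdd n j) = Pauli.Z then (1 : ZMod 2) else 0) * e u j)
      (fun u v => by simp only [map_add, Pi.add_apply, mul_add, Finset.sum_add_distrib])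
    have hφ : ∀ u, φ u = ∑ i : Fin n, (if S (Fin.castAdd n i) = Pauli.Z then (1 : ZMod 2) else 0) * e u i :=
      fun u => rfl
    have hψ : ∀ u, ψ u = ∑ j : Fin n, (if S (Fin.natAdd n j) = Pauli.Z then (1 : ZMod 2) else 0) * e u j :=
      fun u => rfl
    -- reindex the data register by `K`
    have hbij : Function.Bijective (fun x : QReg n => e.symm fun i => if x i then (1 : ZMod 2) else 0) := by
      rw [Fintype.bijective_iff_injective_and_card]
      refine ⟨fun x y hxy => bits_injective (e.symm.injective hxy), ?_⟩
      rw [hK, Fintype.card_fun, Fintype.card_bool, Fintype.card_fin]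
    rw [Fintype.sum_bijective _ hbij _ (fun u => if φ u + ψ (u ^ 3) = 0 then (1 : ℝ) else -1) ?_]
    · by_cases hψ0 : ψ = 0
      · -- all letters on the value register are `I`, so some data letter is `Z` and `φ ≠ 0`
        have hd : ∀ j, S (Fin.natAdd n j) = Pauli.I := by
          intro j
          rcases eq_I_or_eq_Z_of_flipsBit (hfl' (Fin.natAdd n j)) with h | h
          · exact h
          · exfalso
            have h1 := DFunLike.congr_fun hψ0 (e.symm (Pi.single j 1))
            rw [hψ, AddMonoidHom.zero_apply, AddEquiv.apply_symm_apply, Finset.sum_eq_single j,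
              if_pos h, Pi.single_eq_same, one_mul] at h1
            · exact h10 h1
            · intro j' _ hj'
              simp [hj']
            · simp
        have hφ0 : φ ≠ 0 := by
          obtain ⟨k, hk⟩ := Function.ne_iff.1 hS
          revert hk
          refine Fin.addCases (motive := fun k => S k ≠ Pauli.I → φ ≠ 0) (fun i hi => ?_)
            (fun j hj => absurd (hd j) hj) k
          have hZ : S (Fin.castAdd n i) = Pauli.Z := (eq_I_or_eq_Z_of_flipsBit (hfl' _)).resolve_left hi
          intro h0
          have h1 := DFunLike.congr_fun h0 (e.symm (Pi.single i 1))
          rw [hφ, AddMonoidHom.zero_apply, AddEquiv.apply_symm_apply, Finset.sum_eq_single i,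
            if_pos hZ, Pi.single_eq_same, one_mul] at h1
          · exact h10 h1
          · intro i' _ hi'
            simp [hi']
          · simp
        have hψu : ∀ u : K, ψ (u ^ 3) = 0 := fun u => by rw [hψ0, AddMonoidHom.zero_apply]
        simp_rw [hψu, add_zero]
        rw [sum_sign_eq_zero φ hφ0, abs_zero]
        positivity
      · exact abs_walsh_cube_le hK φ ψ hψ0
    · intro x
      simp only [hφ, hψ, AddEquiv.apply_symm_apply]


end Main

end CubeGraphFlat

/-! ### The named fact -/

open CubeGraphFlat in
/-- **`cubeGraphFlat` — DISCHARGED** (the almost-bent witness is flat): for every field `K` with `2ⁿ`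
elements and every additive identification `e : K ≃+ (Fin n → ZMod 2)`, the unnormalised graph vector
`g = Σ_x |x⟩|e((e⁻¹ x)³)⟩` on `n + n` qubits satisfies `|⟨g|σ_S|g⟩| ≤ 2·√2ⁿ` for every Pauli string
`S ≠ I`. [cite: Carlet2020, §11.5.2 (PDF p. 497) and PDF pp. 222–223] [cite: Nyberg1994] [cite: Gold1968] -/
theorem cubeGraphFlat_holds : cubeGraphFlat := by
  unfold cubeGraphFlat
  intro n K _ _ hK e S hS
  exact cubeGraphFlat_main n K hK e S hS


end Literature.Barriers.QuantumAdvantage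

end
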